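import Mathlib
import HarnessLib
import Summits.Ventures.LatticeQCDFlow.Exactness.SUNStoutLayerEquivariance
import Summits.Ventures.LatticeQCDFlow.Exactness.EquivariantJacobianGaugeInvariance
import Summits.Ventures.LatticeQCDFlow.Scoring.HMCKernelChargeConjugation

/-!
# The masked `SU(N)` stout layer commutes with CHARGE CONJUGATION `U ↦ Ū`; its exact Jacobians and its model density are conjugation invariant

HONEST FRAMING: exact (Metropolis-corrected) sampling algorithms for lattice gauge theory;
figures of merit are autocorrelation/cost numbers at stated couplings and volumes; no
continuum-physics claim.

Venture `LatticeQCDFlow` (cell pub-lqcd), topic `Exactness`; FANOUT row 10 (`eng-equiv`, engine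
`latflow.equiv` / `latflow.flows_jax`: `residual.py` stout / stout-defect layers
`V(x,μ) ↦ exp(ρ(V,(x,μ)) • P(Ω_{x,μ}(V))) · V(x,μ)` on active links, `flows_jax.residual_flow`).
NEW WORK of the cell; nothing is cited as a fact; no number; no definition is introduced.  Row 10
typed gauge equivariance (`SUNStoutLayerEquivariance`) and translation covariance
(`KernelCouplingTranslation`, `SUNStoutLayerTranslation`) of this layer; rows 16 / 21 typed charge
conjugation of the HMC kernels (`Scoring.HMCKernelChargeConjugation`: `suProj_mapConj`,
`exp_mapConj`, `plaquetteLoopSum_configConj`, `piHaar_map_configConj`; `GlobalAutomorphismSymmetry`: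
`configConj N : G^E ≃ᵐ G^E`, `suConjAut`, `measurePreserving_configAut_piHaar`).  This file is the
charge-conjugation member of row 10's symmetry series for the stout layer — the third discrete /
space symmetry of the Wilson action after gauge transformations and translations.

## What is typed (every `N`, `d`, `L`, every mask `p`)

* `exp_smul_suProj_mapConj` — `exp(r • P(W̄)) = conj (exp(r • P(W)))` for real `r`: Lüscher's
  projection has real coefficients and `exp` commutes with entrywise conjugation;
* **`sunStoutLayer_configConj`** — with a coefficient field EVEN under conjugation on active links
  (`ρ(V̄, e) = ρ(V, e)`: constants, or a conditioner reading `Re tr` of closed loops — `Im tr`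
  features flip sign and are NOT admissible as they stand) the layer intertwines charge
  conjugation: `F(V̄) = conj (F V)`;
* **`ae_chargeConjInvariant_jacobian_sunStoutLayer`** — every exact Jacobian of the layer for
  product Haar (presented as a measurable automorphism `Ψ`) satisfies `J(Ū) = J(U)` almost
  everywhere; **`chargeConjInvariant_jacobian_sunStoutLayer`** — everywhere for a continuous
  `j ≥ 0` (Liouville's `J` of `SUNStoutLayerJacobian`, or any certified continuous closed form);
  `chargeConjInvariant_modelDensity_sunStoutLayer` — the push-forward density `(r/j) ∘ Ψ⁻¹` of a
  conjugation-invariant prior density is conjugation invariant; so the importance weight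
  `e^{−βS_W}·(J∘Ψ⁻¹)` of the stout flow sampler is conjugation invariant
  (`wilsonAction_configAut` with `re_trace_fundamentalRep_suConjAut`) — the input of the
  sampler-level statement (sequel, with `FlowSamplerTranslationCovariance` §1).

NOT here: the `U(1)` spline layers (conjugation `θ ↦ −θ` commutes with a circular spline iff the
spline is odd — a constraint the engine does not impose); the spectral `SU(N)` kernel (commutes with
`P ↦ P̄` iff the eigenvalue map is odd under `θ ↦ −θ`, likewise not imposed); any number.
-/

noncomputable section

namespace Summit.Ventures.LatticeQCDFlow.Exactness

open Matrix MeasureTheory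
open Literature.MathematicalPhysics.QuantumFieldTheory
open scoped ENNReal ComplexConjugate

variable {d L n : ℕ}

/-! ## The stout factor of the conjugated field is the conjugated stout factor -/

/-- `exp(r • P(W̄)) = conj (exp(r • P(W)))` for real `r`. -/
theorem exp_smul_suProj_mapConj (r : ℝ) (W : Matrix (Fin n) (Fin n) ℂ) :
    NormedSpace.exp ((r : ℂ) • suProj (RingHom.mapMatrix (starRingEnd ℂ) W)) =
      RingHom.mapMatrix (starRingEnd ℂ) (NormedSpace.exp ((r : ℂ) • suProj W)) := by
  rw [Scoring.suProj_mapConj, ← Scoring.exp_mapConj, Scoring.mapConj_smul, Complex.conj_ofReal]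

/-- The stout factor at an active link of the conjugated field is the conjugate of the stout factor,
for a conjugation-even coefficient. -/
theorem stoutFactor_configConj (r : ℝ) (V : GaugeConfig d L (Matrix.specialUnitaryGroup (Fin n) ℂ))
    (x : Site d L) (μ : Fin d) :
    (⟨NormedSpace.exp ((r : ℂ) • suProj (plaquetteLoopSum (configConj n V) x μ)),
        exp_smul_suProj_mem r (plaquetteLoopSum (configConj n V) x μ)⟩ :
        Matrix.specialUnitaryGroup (Fin n) ℂ) =
      suConjAut n ⟨NormedSpace.exp ((r : ℂ) • suProj (plaquetteLoopSum V x μ)),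
        exp_smul_suProj_mem r (plaquetteLoopSum V x μ)⟩ := by
  apply Subtype.ext
  rw [Scoring.coe_suConjAut]
  change NormedSpace.exp ((r : ℂ) • suProj (plaquetteLoopSum (configConj n V) x μ)) =
    RingHom.mapMatrix (starRingEnd ℂ) (NormedSpace.exp ((r : ℂ) • suProj (plaquetteLoopSum V x μ)))
  rw [Scoring.plaquetteLoopSum_configConj, exp_smul_suProj_mapConj]

/-- The same with the coefficient supplied up to an equation (the form used under a mask, where the
coefficient of the conjugated field is only KNOWN to equal that of the field on active links). -/
theorem stoutFactor_configConj_of_eq {r r' : ℝ} (hr : r' = r)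
    (V : GaugeConfig d L (Matrix.specialUnitaryGroup (Fin n) ℂ)) (x : Site d L) (μ : Fin d) :
    (⟨NormedSpace.exp ((r' : ℂ) • suProj (plaquetteLoopSum (configConj n V) x μ)),
        exp_smul_suProj_mem r' (plaquetteLoopSum (configConj n V) x μ)⟩ :
        Matrix.specialUnitaryGroup (Fin n) ℂ) =
      suConjAut n ⟨NormedSpace.exp ((r : ℂ) • suProj (plaquetteLoopSum V x μ)),
        exp_smul_suProj_mem r (plaquetteLoopSum V x μ)⟩ := by
  subst hr
  exact stoutFactor_configConj r' V x μ

/-! ## The layer intertwines charge conjugation -/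

/-- **The masked `SU(N)` stout layer commutes with charge conjugation**: for a coefficient field
even under conjugation on active links, `F(V̄) = conj (F V)` (link by link: the frozen links are
conjugated, the active ones pick up the conjugated stout factor — `suConjAut` is multiplicative). -/
theorem sunStoutLayer_configConj (p : Edge d L → Prop) [DecidablePred p]
    (ρ : GaugeConfig d L (Matrix.specialUnitaryGroup (Fin n) ℂ) → Edge d L → ℝ)
    (hρC : ∀ (V : GaugeConfig d L (Matrix.specialUnitaryGroup (Fin n) ℂ)) (e : Edge d L), p e →
      ρ (configConj n V) e = ρ V e)
    (V : GaugeConfig d L (Matrix.specialUnitaryGroup (Fin n) ℂ)) :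
    (fun e : Edge d L =>
        if p e then
          (⟨NormedSpace.exp ((ρ (configConj n V) e : ℂ) • suProj (plaquetteLoopSum (configConj n V) e.1 e.2)),
              exp_smul_suProj_mem (ρ (configConj n V) e) (plaquetteLoopSum (configConj n V) e.1 e.2)⟩ :
              Matrix.specialUnitaryGroup (Fin n) ℂ) * configConj n V e
        else configConj n V e) =
      configConj n (fun e : Edge d L =>
        if p e then
          (⟨NormedSpace.exp ((ρ V e : ℂ) • suProj (plaquetteLoopSum V e.1 e.2)),
              exp_smul_suProj_mem (ρ V e) (plaquetteLoopSum V e.1 e.2)⟩ :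
              Matrix.specialUnitaryGroup (Fin n) ℂ) * V e
        else V e) := by
  funext e
  simp only [configAut_apply]
  by_cases he : p e
  · rw [if_pos he, if_pos he, map_mul, stoutFactor_configConj_of_eq (hρC V e he)]
  · rw [if_neg he, if_neg he]

/-! ## Exact Jacobians and the model density are conjugation invariant -/

section Jacobian

variable [NeZero L] (p : Edge d L → Prop) [DecidablePred p]
  (ρ : GaugeConfig d L (Matrix.specialUnitaryGroup (Fin n) ℂ) → Edge d L → ℝ)
  (hρC : ∀ (V : GaugeConfig d L (Matrix.specialUnitaryGroup (Fin n) ℂ)) (e : Edge d L), p e →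
    ρ (configConj n V) e = ρ V e)
  (Ψ : GaugeConfig d L (Matrix.specialUnitaryGroup (Fin n) ℂ) ≃ᵐ
    GaugeConfig d L (Matrix.specialUnitaryGroup (Fin n) ℂ))
  (hΨ : ⇑Ψ = fun (V : GaugeConfig d L (Matrix.specialUnitaryGroup (Fin n) ℂ)) (e : Edge d L) =>
    if p e then
      (⟨NormedSpace.exp ((ρ V e : ℂ) • suProj (plaquetteLoopSum V e.1 e.2)),
          exp_smul_suProj_mem (ρ V e) (plaquetteLoopSum V e.1 e.2)⟩ :
        Matrix.specialUnitaryGroup (Fin n) ℂ) * V e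
    else V e)

include hρC hΨ

omit [NeZero L] in
/-- The layer, presented as a measurable automorphism `Ψ` of `SU(N)^E`, commutes with `configConj`. -/
theorem sunStoutLayer_equiv_configConj (V : GaugeConfig d L (Matrix.specialUnitaryGroup (Fin n) ℂ)) :
    Ψ (configConj n V) = configConj n (Ψ V) := by
  rw [hΨ]
  exact sunStoutLayer_configConj p ρ hρC V

/-- **Every exact Jacobian of the masked `SU(N)` stout layer is charge-conjugation invariant almost
everywhere** (product Haar; any presentation `Ψ`, any exact Jacobian `J` of it — two exact Jacobians
of one automorphism agree a.e., and `J ∘ configConj` is one because conjugation preserves Haar). -/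
theorem ae_chargeConjInvariant_jacobian_sunStoutLayer
    {J : GaugeConfig d L (Matrix.specialUnitaryGroup (Fin n) ℂ) → ℝ≥0∞}
    (h : HasJacobian (Measure.pi fun _ : Edge d L => haarProbability (Matrix.specialUnitaryGroup (Fin n) ℂ)) Ψ J) :
    ∀ᵐ U ∂(Measure.pi fun _ : Edge d L => haarProbability (Matrix.specialUnitaryGroup (Fin n) ℂ)),
      J (configConj n U) = J U := by
  have hae := h.jac_comp_symm_ae_eq (configConj n)
    (measurePreserving_configAut_piHaar (d := d) (L := L) (suConjAut n))
    (sunStoutLayer_equiv_configConj p ρ hρC Ψ hΨ)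
  filter_upwards [hae] with U hU
  exact hU

/-- **… and everywhere for a continuous exact Jacobian `j ≥ 0`.** -/
theorem chargeConjInvariant_jacobian_sunStoutLayer
    {j : GaugeConfig d L (Matrix.specialUnitaryGroup (Fin n) ℂ) → ℝ} (hj : Continuous j) (hj0 : ∀ U, 0 ≤ j U)
    (h : HasJacobian (Measure.pi fun _ : Edge d L => haarProbability (Matrix.specialUnitaryGroup (Fin n) ℂ)) Ψ
      (fun U => ENNReal.ofReal (j U)))
    (U : GaugeConfig d L (Matrix.specialUnitaryGroup (Fin n) ℂ)) : j (configConj n U) = j U := by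
  haveI : SecondCountableTopology (Matrix (Fin n) (Fin n) ℂ) :=
    inferInstanceAs (SecondCountableTopology (Fin n → Fin n → ℂ))
  haveI : SecondCountableTopology (Matrix.specialUnitaryGroup (Fin n) ℂ) :=
    Topology.IsEmbedding.subtypeVal.secondCountableTopology
  haveI : (haarProbability (Matrix.specialUnitaryGroup (Fin n) ℂ)).IsOpenPosMeasure := by
    unfold haarProbability; infer_instance
  have hTc : Continuous (configConj (d := d) (L := L) n) :=
    continuous_pi fun e => (suConjAut n).continuous.comp (continuous_apply e)
  have h1 := HasJacobian.jac_comp_symm_eq hj h (configConj n)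
    (measurePreserving_configAut_piHaar (d := d) (L := L) (suConjAut n)) hTc
    (sunStoutLayer_equiv_configConj p ρ hρC Ψ hΨ) U
  exact (ENNReal.ofReal_eq_ofReal_iff (hj0 _) (hj0 _)).1 h1

/-- **The stout flow's model density is charge-conjugation invariant**: for a conjugation-invariant
prior density `r` and a continuous exact Jacobian `j ≥ 0`, `((r/j) ∘ Ψ⁻¹)(Ū) = ((r/j) ∘ Ψ⁻¹)(U)`. -/
theorem chargeConjInvariant_modelDensity_sunStoutLayer
    {j r : GaugeConfig d L (Matrix.specialUnitaryGroup (Fin n) ℂ) → ℝ} (hj : Continuous j) (hj0 : ∀ U, 0 ≤ j U)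
    (h : HasJacobian (Measure.pi fun _ : Edge d L => haarProbability (Matrix.specialUnitaryGroup (Fin n) ℂ)) Ψ
      (fun U => ENNReal.ofReal (j U)))
    (hr : ∀ V : GaugeConfig d L (Matrix.specialUnitaryGroup (Fin n) ℂ), r (configConj n V) = r V)
    (U : GaugeConfig d L (Matrix.specialUnitaryGroup (Fin n) ℂ)) :
    r (Ψ.symm (configConj n U)) / j (Ψ.symm (configConj n U)) = r (Ψ.symm U) / j (Ψ.symm U) := by
  have hsymm : Ψ.symm (configConj n U) = configConj n (Ψ.symm U) := by
    apply Ψ.injective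
    rw [Ψ.apply_symm_apply, sunStoutLayer_equiv_configConj p ρ hρC Ψ hΨ, Ψ.apply_symm_apply]
  rw [hsymm, hr, chargeConjInvariant_jacobian_sunStoutLayer p ρ hρC Ψ hΨ hj hj0 h (Ψ.symm U)]

/-- **The stout flow sampler's importance weight `e^{−βS_W}·(J∘Ψ⁻¹)` (fundamental Wilson action) is
charge-conjugation invariant** — the weight hypothesis of `conjKernel_indepMH_eq_self`. -/
theorem chargeConjInvariant_flowWeight_sunStoutLayer (β : ℝ)
    {j : GaugeConfig d L (Matrix.specialUnitaryGroup (Fin n) ℂ) → ℝ} (hj : Continuous j) (hj0 : ∀ U, 0 ≤ j U)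
    (h : HasJacobian (Measure.pi fun _ : Edge d L => haarProbability (Matrix.specialUnitaryGroup (Fin n) ℂ)) Ψ
      (fun U => ENNReal.ofReal (j U)))
    (U : GaugeConfig d L (Matrix.specialUnitaryGroup (Fin n) ℂ)) :
    Real.exp (-β * wilsonAction (Literature.MathematicalPhysics.QuantumLattice.fundamentalRep (Fin n))
        (configConj n U)) * j (Ψ.symm (configConj n U)) =
      Real.exp (-β * wilsonAction (Literature.MathematicalPhysics.QuantumLattice.fundamentalRep (Fin n)) U) *
        j (Ψ.symm U) := by
  have hsymm : Ψ.symm (configConj n U) = configConj n (Ψ.symm U) := by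
    apply Ψ.injective
    rw [Ψ.apply_symm_apply, sunStoutLayer_equiv_configConj p ρ hρC Ψ hΨ, Ψ.apply_symm_apply]
  rw [hsymm, chargeConjInvariant_jacobian_sunStoutLayer p ρ hρC Ψ hΨ hj hj0 h (Ψ.symm U),
    wilsonAction_configAut (re_trace_fundamentalRep_suConjAut n)]

end Jacobian

end Summit.Ventures.LatticeQCDFlow.Exactness

end
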